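import Summits.QuantumFields.YangMills.Theorems.BalabanUVNodesN08AlphaEq324RowClassSocketEndIndexed
import Literature.MathematicalPhysics.QuantumFieldTheory.Balaban1983to89.B1Eq324BenfattoClassSectEMember

/-!
# Route «BalabanUVNodes», Track-A DAG node N08 = [Balaban1985UV3] Thm 1 p. 257 ∕ Thm 2 p. 272 — THE (α)-SOCKET AT N06's SECT. E LETTERS:
# the (3.24) row `h324` of the edited clauses at EVERY run step for an a.e. presentation of the step block by the Gaussian `𝒩(0, (Cᵀ(P − a·1 − 𝒥)C)⁻¹)`
# of [Balaban1985BackgroundPropagators] (3.156)–(3.158) on the block's OWN torus-indexed variables, N06's inputs DISPLAYED — precision side (§1–§2) and PRINT's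
# output letters `γ₀ ≤ C*Δ_kC ≤ γ₁` + the (3.187) decay of the propagator `C̃^{(k)} = (C*Δ_kC)⁻¹` (§3, covariance side) (part 9 of the class socket)

Cell `pub-ymgap`, seat `pub-ymgap-dag-n08-w4` gen 6 (CLAIM-4 ∕ INTENT-4, INBOX l.40656).  `bears_on: R4∕N08`; filed `--supports stmt-QuantumFields-27364` (K1⁹, helper).  THEOREMS ONLY
(def-free, sorry-free, standard axioms); seat n08-b's `…ClassSectEMember.eq324_sectEPrecision_torus_on_unit` ∕ `…_of_gamma0Assembly_on_unit` (gen 15, p-landed 15:4xZ), part 4's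
`…ClassSocketApprox.h324Row_freeLetter_of_postConsumer_ae` (p636897) and part 8's `…ClassSocketEndIndexed.preimage_box_ae_eq_smallFieldSet_all` consumed BY NAME.

WHY.  Part 8 (`…ClassSocketEndIndexed`) put the socket's mouth at the block's own variables with an ABSTRACT precision `T` (symmetric, coercive, torus-metric
decay).  [Balaban1985UV3] p. 271 names the precision: *«the Gaussian integral determined by the positive quadratic form ⟨A, C*Δ_kCA⟩»*, with `Δ_k` the operator of
[Balaban1985BackgroundPropagators] (3.156) `⟨B,(QG₁Q*)⁻¹B⟩ − a⟨B,B⟩ − 2⟨H₁D̃^{(2)}B, J⟩` and `C` the elimination operator of (3.157)–(3.158); seat n08-b's gen-15 matrix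
skeleton turns N06's Sect.-E-shaped inputs — the (3.132)-type decay of `P = (QG₁Q*)⁻¹` and of the J-term, `|a| ≤ a₀`, the locality and column sums of `C`, the lower
bound `γ₀` (GAPS G-B9-09: asserted in print) — into (3.24) for `μ_{(Cᵀ(P − a·1 − 𝒥)C)⁻¹}` on a labelled torus block, Literature-side.  This part is the Summits-side
consumption: the same inputs, a `StepSeries` block presented by that Gaussian, the Hamiltonian letters on the bent window ⟹ `StepAlphaEq324CoreLTAtAC.h324` ∕
`…CoreLTAt.h324` at the free letter, every run step — i.e. row `h324`'s member half written in the letters N06 delivers, leaving to the IDENT exactly: NODE 00's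
identification of `(𝔖 k).μ ∕ box ∕ 𝒱` with `𝒩(0,(CᵀΔ_kC)⁻¹)` ∕ the uniform box ∕ a (4.5)-polynomial (`Φ`, `hbox`, `hV`, `hH`), N06's four matrix inputs + `γ₀` at [B10]'s
data, the window `b₁ < b₀` and the budget.
* §1 ★★★★ `exists_threshold_h324Row_freeLetter_of_sectEPrecisionTorusPresentation_allSteps_ae` — `∃ b₁ ∀ b₀ > b₁ ∃ C ≥ 0 ∀ S ∀ k ≤ K ∀ v (C·v ≤ Ca + Cc)`, for every
  ambient Sect.-E index space `υ` (finite) with a pseudo-distance `ρ`, every per-(h,U) variable set `B h U` (torus sites `site`, labels `lab`, positions `emb : B h U → υ`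
  with `ρ ∘ emb` dominating the torus sup-distance), every per-(h,U) `P, J : Matrix υ υ ℝ` (symmetric, `K_P e^{−δρ}` ∕ `K_J e^{−δρ}`), `|a| ≤ a₀`, `E : Matrix υ (B h U) ℝ`
  (`E u b ≠ 0 ⇒ ρ u (emb b) ≤ r`, `Σ_u |E u b| ≤ m_C`), `γ₀`-coercivity of `Eᵀ(P − a·1 − J)E` ⟹ `∃ (Λ, e)` on the bent window `ℤ^{2d_T+1}` (n08-b's kit, chosen per
  (h,U), BEFORE the tower data: `(Λ, e)` depend on the member only) such that for EVERY `𝔖` and EVERY measurable `Φ h U : (B h U → ℝ) → Fl` with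
  `(𝔖 k).μ = 𝒩(0,(Eᵀ(P − a·1 − J)E)⁻¹).map Φ`, `Φ⁻¹'box =ᵐ {|ω_b| ≤ p(g_k) ∀ b}`, `𝒱 ∘ Φ =ᵐ H`,
  `H (z ∘ e) = H^{aw}_{Jw} z` (`Jw ⊆ Λ`, `sup|coeff| ≤ c₀ g_k^σ`), `|B h U| ≤ v·|T₁^{(k)}|` gives `h324`.
* §2 ★★★★ `exists_threshold_h324Row_freeLetter_of_gamma0AssemblyTorusPresentation_allSteps_ae` — the same with the scalar `γ₀` NOT read as a coercivity row but
  DERIVED inside n08-b's §4 from the interface of cell pub-balaban's written γ₀-assembly (`B9SectEKernel.gamma0_assembly`): `QH = 1`, `(K + aQᵀQ)H = QᵀP`, `0 < κ₁`,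
  (h1) covariant Stokes `F(QA) ≤ κ₁⟨A, KA⟩ + κ₂‖QA‖²`, (h2) `good B → c₂‖B‖² ≤ F B`, (hJ) `|⟨B, JB⟩| ≤ θ‖B‖²`, `γ₀ ≤ (c₂ − κ₂)∕κ₁ − θ`, `good (E x)`, `‖x‖² ≤ ‖Ex‖²` —
  GAPS G-B9-09's asserted lower bound replaced by its analytic inputs ([B9] Thms 3.3 ∕ 3.11 ∕ 3.12, (3.36), [PropII] Lemma 2.4), DISPLAYED.
* §3 ★★★★ `exists_threshold_h324Row_freeLetter_of_sectECovarianceTorusPresentation_allSteps_ae` — PRINT's OUTPUT LETTERS: precision `T h U` on the block's own variables with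
  `γ₀ Σx² ≤ ΣΣ T x x ≤ γ₁ Σx²` ([Balaban1985UV3] p.271 «γ₀ … γ₁ is an upper bound of the positive, bounded operator C*Δ_kC») and `|(T h U)⁻¹ b b′| ≤ B₀ e^{−δ₀ρ(b,b′)}`
  ([B9] Thm 3.15 (3.187) for `C̃^{(k)}(Λ) = (C*Δ_kC)⁻¹`, (3.158)), torus placement ⟹ `∃ (Λ, e)` such that every presentation by `𝒩(0, T⁻¹)` as above gives `h324`.
A6 (№189).  Inhabited at the one-variable block (`υ = B = {⋆}`, `P = (γ₀ + a)·1`, `J = 0`, `E = 1`, `ρ = 0`; §3: `T = γ₀·1`, `γ₀ ≤ γ₁`, `γ₀⁻¹ ≤ B₀`): n08-b's file carries the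
scalar-side `example`s; the presentation rows are those certified in `…ClassSocketEndInhabited` (p645090) ∕ `…EndCovInhabited` (p646042); not re-typed here.
HONEST SCOPE.  A composition by name (`choose` over n08-b's capstone at `η := g_k`, `Measure.map_map`, `QuasiMeasurePreserving.preimage_ae_eq`, `ae_eq_comp`, part 4's plug);
the Sect.-E inputs are DISPLAYED hypotheses — N06's ([B9] Thms 3.3 ∕ 3.11 ∕ 3.12 ∕ 3.15, (3.132), G-B9-09) content at [B10]'s data, NOT proved here; the junction to def-Y's
`Node00.OpsYSectE` letters and NODE 00's `(𝔖 k).μ ∕ box ∕ 𝒱` is THE IDENT — NOT made, NOT commissioned, NOT claimed; nothing of [Balaban1985UV3] ∕ [Balaban1984UV2] ∕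
[BenfattoEtAl1978] ∕ [Balaban1985BackgroundPropagators] asserted or discharged; `PrintedUV3V` NOT proved; N08 NOT discharged; count-neutral; one finite 𝕋⁴ programme at
fixed ε — R4 closes the conditional finite-𝕋⁴ rung `BalabanLadder.UV` only; nothing continuum ∕ ℝ⁴ ∕ OS ∕ mass gap ∕ Clay.
-/
noncomputable section

namespace Summit.QuantumFields.YangMills.Theorems.BalabanUVNodesN08AlphaEq324RowClassSocketEndSectE

open MeasureTheory
open scoped BigOperators Nat Matrix
open Literature.MathematicalPhysics.QuantumFieldTheory (gaussianFieldOfKernel)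
open Literature.MathematicalPhysics.QuantumFieldTheory.Balaban1983to89
open Literature.MathematicalPhysics.QuantumFieldTheory.Balaban1983to89.B1Sect3Statements (Eq324)
open Literature.MathematicalPhysics.QuantumFieldTheory.Balaban1983to89.B1Eq324BenfattoLemma (Coef hamiltonian coefSup smallFieldSet)
open Literature.MathematicalPhysics.QuantumFieldTheory.Balaban1983to89.B4Sect5Torus (IsPseudoDist)
open Literature.MathematicalPhysics.QuantumFieldTheory.Balaban1983to89.B1Eq324BenfattoClassPresentation (measurable_restrictAlong)
open Literature.MathematicalPhysics.QuantumFieldTheory.Balaban1983to89.B1Eq324BenfattoClassSectEMember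
  (eq324_sectEPrecision_torus_on_unit eq324_sectEPrecision_torus_of_gamma0Assembly_on_unit eq324_sectECovariance_torus_on_unit)
open Literature.MathematicalPhysics.QuantumFieldTheory.Balaban1985CMP102.Setting
open Summit.QuantumFields.Balaban3D.Carriers
open Summit.QuantumFields.Balaban3D.Proofs.ScalesArithmetic (gk_pos gk_le_one)
open Summit.QuantumFields.Balaban3D.Proofs.Primitives (AlphaConsts)
open Summit.QuantumFields.Balaban3D.Proofs.GroupModelLieC (lieC)
open Summit.QuantumFields.YangMills.Theorems.BalabanUVNodesN08AlphaEq324RowClassSocketApprox (h324Row_freeLetter_of_postConsumer_ae)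
open Summit.QuantumFields.YangMills.Theorems.BalabanUVNodesN08AlphaEq324RowClassSocketEndIndexed (preimage_box_ae_eq_smallFieldSet_of_nonneg)
open Literature.Probability.LatticeModels (cumulantOf)

variable {L : ℕ} {G : Type} [GaugeGroup G] [MeasurableSpace G] [HaarData G] (𝔊 : GroupModel G) (𝔠 : AlphaConsts L 𝔊.N)

/-- ★★★★ **ROW `h324` AT EVERY RUN STEP FROM A PRESENTATION BY THE SECT. E GAUSSIAN `𝒩(0, (Eᵀ(P − a·1 − 𝒥)E)⁻¹)` ON TORUS-INDEXED VARIABLES, N06's INPUTS DISPLAYED**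
(statement in the module docstring).  `b₁` depends on `(d_T, m, γ₀, K_P, K_J, a₀, δ, r, m_C, D, ϰ, p₀, σ, c₀, n̄, κ₀)` only; for `b₀ > b₁` the constant `C` on those and `b₀`;
the index spaces, matrices, placements and the presentation may depend on `(h, U)` and on the step.
[cite: Balaban1985UV3, (22) p.261 + (58) p.270 + p.271 «⟨A, C*Δ_kCA⟩»; Balaban1985BackgroundPropagators, (3.132) p.422 + (3.156)–(3.158) p.428 + (3.187) p.432;
Balaban1982Higgs1, (3.24) p.616; BenfattoEtAl1978, Lemma p.152 (class form; ours)] -/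
theorem exists_threshold_h324Row_freeLetter_of_sectEPrecisionTorusPresentation_allSteps_ae {dT : ℕ} (hdT : 0 < dT) (m : ℕ)
    {γ₀ KP KJ a₀ δ r mC : ℝ} (hγ₀ : 0 < γ₀) (hKP : 0 ≤ KP) (hKJ : 0 ≤ KJ) (ha₀ : 0 ≤ a₀) (hδ : 0 < δ) (hmC : 0 ≤ mC)
    (D : ℕ) {ϰ : ℝ} (hϰ : 0 < ϰ) {p₀ σ c₀ : ℝ} (hp₀ : 2 / 3 < p₀) (hσ : 0 < σ) (hc₀ : 0 ≤ c₀) (hκσ : 6 + 2 * 𝔠.κ₀ < σ * (𝔠.nbar + 1)) :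
    ∃ b₁ : ℝ, ∀ b₀ : ℝ, b₁ < b₀ → ∃ C : ℝ, 0 ≤ C ∧
      ∀ (S : Scales L) (k : ℕ), k ≤ S.K → ∀ (v : ℝ), C * v ≤ 𝔠.Ca + 𝔠.Cc →
        ∀ {ι υ : Type} [DecidableEq ι] [Fintype υ] [DecidableEq υ] {N : ℕ} [NeZero N] (ρ : υ → υ → ℝ), IsPseudoDist ρ →
        ∀ (B : Hist S.P (k + 1) → GaugeField S.P (k + 1) G → Finset ι)
          (site : ∀ h U, ↥(B h U) → Fin dT → ZMod N) (lab : ∀ h U, ↥(B h U) → Fin m) (emb : ∀ h U, ↥(B h U) → υ)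
          (P J : Hist S.P (k + 1) → GaugeField S.P (k + 1) G → Matrix υ υ ℝ) (a : Hist S.P (k + 1) → GaugeField S.P (k + 1) G → ℝ)
          (E : ∀ h U, Matrix υ ↥(B h U) ℝ),
          -- the variables: placed on the unit torus with labels; `emb` = their position in the ambient Sect.-E index space `υ` (bonds of `Λ̃`)
          (∀ h U, (B h U).Nonempty) → (∀ h U, Function.Injective fun b => (site h U b, lab h U b)) →
          (∀ h U b b' i, (|((site h U b i - site h U b' i).valMinAbs : ℤ)| : ℝ) ≤ ρ (emb h U b) (emb h U b')) →
          -- N06's Sect.-E inputs (DISPLAYED): (3.132)-type decay of `P = (QG₁Q*)⁻¹` and of the J-term, `|a| ≤ a₀`, locality and column sums of `E = C`, `γ₀`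
          (∀ h U u w, P h U u w = P h U w u) → (∀ h U u w, J h U u w = J h U w u) →
          (∀ h U u w, |P h U u w| ≤ KP * Real.exp (-(δ * ρ u w))) → (∀ h U u w, |J h U u w| ≤ KJ * Real.exp (-(δ * ρ u w))) →
          (∀ h U, |a h U| ≤ a₀) → (∀ h U u b, E h U u b ≠ 0 → ρ u (emb h U b) ≤ r) → (∀ h U b, ∑ u, |E h U u b| ≤ mC) →
          (∀ h U (x : ↥(B h U) → ℝ), γ₀ * ∑ b, x b ^ 2 ≤
            ∑ b, ∑ b', ((E h U)ᵀ * (P h U - a h U • (1 : Matrix υ υ ℝ) - J h U) * E h U) b b' * x b * x b') →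
        ∃ (Λ : Hist S.P (k + 1) → GaugeField S.P (k + 1) G → Finset (Fin (dT + dT + 1) → ℤ)) (e : ∀ h U, ↥(B h U) ≃ ↥(Λ h U)),
        ∀ (𝔖 : ∀ k, StepSeries S G ↥(lieC 𝔊) (nblkOf S 𝔠.lane.carrier k) k)
          (Φ : ∀ h U, (↥(B h U) → ℝ) → (𝔖 k).Fl) (H : ∀ h U, (↥(B h U) → ℝ) → ℝ)
          (s : ℕ) (Jw : Hist S.P (k + 1) → GaugeField S.P (k + 1) G → Finset (Fin (dT + dT + 1) → ℤ))
          (aw : Hist S.P (k + 1) → GaugeField S.P (k + 1) G → Coef (dT + dT + 1)),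
          -- the a.e. presentation by `𝒩(0, (Eᵀ(P − a·1 − 𝒥)E)⁻¹)` on the block's own variables
          (∀ h U, Measurable (Φ h U)) →
          (∀ h U, (𝔖 k).μ = (gaussianFieldOfKernel fun b b' =>
            (((E h U)ᵀ * (P h U - a h U • (1 : Matrix υ υ ℝ) - J h U) * E h U)⁻¹ : Matrix ↥(B h U) ↥(B h U) ℝ) b b').map (Φ h U)) →
          (∀ h, MeasurableSet ((𝔖 k).box h)) → (∀ h U, Measurable ((𝔖 k).𝒱 h U)) →
          (∀ h U, Φ h U ⁻¹' (𝔖 k).box h =ᵐ[gaussianFieldOfKernel fun b b' =>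
            (((E h U)ᵀ * (P h U - a h U • (1 : Matrix υ υ ℝ) - J h U) * E h U)⁻¹ : Matrix ↥(B h U) ↥(B h U) ℝ) b b']
            {ω | ∀ b, |ω b| ≤ B10.pFun b₀ p₀ (S.gk k)}) →
          (∀ h U, (fun ω => (𝔖 k).𝒱 h U (Φ h U ω)) =ᵐ[gaussianFieldOfKernel fun b b' =>
            (((E h U)ᵀ * (P h U - a h U • (1 : Matrix υ υ ℝ) - J h U) * E h U)⁻¹ : Matrix ↥(B h U) ↥(B h U) ℝ) b b'] H h U) →
          -- the Hamiltonian letters on the bent window (class II)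
          (∀ h U (z : (Fin (dT + dT + 1) → ℤ) → ℝ), H h U (fun b => z ((e h U b : ↥(Λ h U)) : Fin (dT + dT + 1) → ℤ)) =
            hamiltonian s D ϰ (aw h U) (Jw h U) z) →
          (∀ h U, Jw h U ⊆ Λ h U) → (∀ h U, coefSup s D (aw h U) (Jw h U) ≤ c₀ * S.gk k ^ σ) → (∀ h U, ((B h U).card : ℝ) ≤ v * S.sites k) →
          ∀ h (U : GaugeField S.P (k + 1) G),
            Eq324 (∫ ω in (𝔖 k).box h, Real.exp ((𝔖 k).𝒱 h U ω) ∂(𝔖 k).μ)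
              (fun n => cumulantOf (fun m => ∫ ω, (𝔖 k).𝒱 h U ω ^ m ∂(𝔖 k).μ) n) 𝔠.nbar (𝔠.Ca + 𝔠.Cc)
              ((L : ℝ) ^ k * S.g0sq) (3 + 𝔠.κ₀) (S.sites k) := by
  obtain ⟨b₁, hb₁⟩ := eq324_sectEPrecision_torus_on_unit (d := dT) hdT m hγ₀ hKP hKJ ha₀ hδ hmC 𝔠.nbar D hϰ hp₀ hσ hc₀
    (κ := 6 + 2 * 𝔠.κ₀) (by linarith [𝔠.κ₀_pos]) hκσ
  refine ⟨b₁, fun b₀ hb => ?_⟩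
  obtain ⟨C, hC, hcap⟩ := hb₁ b₀ hb
  refine ⟨C, hC, ?_⟩
  intro S k hk v hCv ι υ _ _ _ N _ ρ hρ B site lab emb P J a E hB hinj hdom hPs hJs hPd hJd ha hEloc hEsum hγ
  -- n08-b's Sect.-E capstone at `η := g_k`, per `(h, U)`: the bent window, the bijection, the Gaussian bridge, the box identity and (3.24) for `μ_K`
  have hkit := fun h U => by
    haveI : Nonempty ↥(B h U) := (hB h U).coe_sort
    exact hcap (S.gk k) (gk_pos S k) (gk_le_one S S.gK_le_one k hk) ρ hρ (site h U) (lab h U) (hinj h U) (emb h U) (hdom h U)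
      (hPs h U) (hJs h U) (hPd h U) (hJd h U) (ha h U) (hEloc h U) (hEsum h U) (hγ h U)
  choose Λ e hbridge hboxkit hE using hkit
  refine ⟨Λ, e, ?_⟩
  intro 𝔖 Φ H s Jw aw hΦ hμ hboxm hVm hbox hV hH hJΛ hA hBv
  refine h324Row_freeLetter_of_postConsumer_ae 𝔊 𝔠 𝔖 k (b₀ := b₀) (p₀ := p₀) hC hCv
    (fun h U => gaussianFieldOfKernel fun x y => if hxy : x ∈ Λ h U ∧ y ∈ Λ h U then
      ((Matrix.reindex (e h U) (e h U) ((E h U)ᵀ * (P h U - a h U • (1 : Matrix υ υ ℝ) - J h U) * E h U))⁻¹ :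
        Matrix ↥(Λ h U) ↥(Λ h U) ℝ) ⟨x, hxy.1⟩ ⟨y, hxy.2⟩ else 0)
    (fun h U z => Φ h U (fun b => z ((e h U b : ↥(Λ h U)) : Fin (dT + dT + 1) → ℤ)))
    (fun h U => (hΦ h U).comp (measurable_restrictAlong (e h U))) (fun h U => ?_) hboxm hVm Λ (fun h U => ?_)
    (fun h U => hamiltonian s D ϰ (aw h U) (Jw h U)) (fun h U => ?_) ?_ (fun h U => ?_)
  · rw [hμ h U, ← hbridge h U, Measure.map_map (hΦ h U) (measurable_restrictAlong (e h U))]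
    rfl
  · have hq : Measure.QuasiMeasurePreserving (fun (z : (Fin (dT + dT + 1) → ℤ) → ℝ) (b : ↥(B h U)) => z ((e h U b : ↥(Λ h U)) : Fin (dT + dT + 1) → ℤ))
        (gaussianFieldOfKernel fun x y => if hxy : x ∈ Λ h U ∧ y ∈ Λ h U then
          ((Matrix.reindex (e h U) (e h U) ((E h U)ᵀ * (P h U - a h U • (1 : Matrix υ υ ℝ) - J h U) * E h U))⁻¹ :
            Matrix ↥(Λ h U) ↥(Λ h U) ℝ) ⟨x, hxy.1⟩ ⟨y, hxy.2⟩ else 0)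
        (gaussianFieldOfKernel fun b b' =>
          (((E h U)ᵀ * (P h U - a h U • (1 : Matrix υ υ ℝ) - J h U) * E h U)⁻¹ : Matrix ↥(B h U) ↥(B h U) ℝ) b b') :=
      ⟨measurable_restrictAlong (e h U), by rw [hbridge h U]⟩
    have h1 := hq.preimage_ae_eq (hbox h U)
    rw [← Set.preimage_comp] at h1
    haveI : Nonempty ↥(B h U) := (hB h U).coe_sort
    exact h1.trans (preimage_box_ae_eq_smallFieldSet_of_nonneg (e h U) _ (hboxkit h U) _)
  · have h1 := ae_eq_comp (g := fun ω => (𝔖 k).𝒱 h U (Φ h U ω)) (g' := H h U) (measurable_restrictAlong (e h U)).aemeasurable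
      (μ := gaussianFieldOfKernel fun x y => if hxy : x ∈ Λ h U ∧ y ∈ Λ h U then
          ((Matrix.reindex (e h U) (e h U) ((E h U)ᵀ * (P h U - a h U • (1 : Matrix υ υ ℝ) - J h U) * E h U))⁻¹ :
            Matrix ↥(Λ h U) ↥(Λ h U) ℝ) ⟨x, hxy.1⟩ ⟨y, hxy.2⟩ else 0)
      (by rw [hbridge h U]; exact hV h U)
    refine h1.trans (Filter.EventuallyEq.of_eq ?_)
    funext z
    exact hH h U z
  · intro h U
    have : (Λ h U).card = (B h U).card := by
      rw [← Fintype.card_coe, ← Fintype.card_coe]; exact (Fintype.card_congr (e h U)).symm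
    rw [this]; exact hBv h U
  · obtain ⟨b, hb⟩ := hB h U
    exact hE h U s (Λ h U) (Jw h U) (aw h U) ⟨_, (e h U ⟨b, hb⟩).2⟩ (hJΛ h U) (hJΛ h U) (hA h U)

/-! ## §2 The same with `γ₀` derived from the γ₀-assembly interface (GAPS G-B9-09's inputs instead of its conclusion) -/

/-- ★★★★ **ROW `h324` AT EVERY RUN STEP FROM THE SECT. E GAUSSIAN, THE LOWER BOUND `γ₀` DERIVED FROM THE γ₀-ASSEMBLY INTERFACE** (n08-b's
`eq324_sectEPrecision_torus_of_gamma0Assembly_on_unit` ∘ the plumbing of §1): the displayed N06 inputs are `QH = 1`, `(K + aQᵀQ)H = QᵀP`, `0 < κ₁`, (h1), (h2), (hJ),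
`γ₀ ≤ (c₂ − κ₂)∕κ₁ − θ`, `good (E x)`, `‖x‖² ≤ ‖Ex‖²`, the (3.132)-type decay of `P` and `J`, `|a| ≤ a₀`, the locality and column sums of `E`; everything per `(h, U)` except the
scalars. [cite: Balaban1985UV3, (58) p.270 + p.271; Balaban1985BackgroundPropagators, Thm 3.3 (3.36) p.400 + (3.132) p.422 + (3.156)–(3.158) p.428; Balaban1984PropagatorsII, Lemma 2.4 p.234;
Balaban1982Higgs1, (3.24) p.616; BenfattoEtAl1978, Lemma p.152 (class form; ours)] -/
theorem exists_threshold_h324Row_freeLetter_of_gamma0AssemblyTorusPresentation_allSteps_ae {dT : ℕ} (hdT : 0 < dT) (m : ℕ)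
    {γ₀ KP KJ a₀ δ r mC : ℝ} (hγ₀ : 0 < γ₀) (hKP : 0 ≤ KP) (hKJ : 0 ≤ KJ) (ha₀ : 0 ≤ a₀) (hδ : 0 < δ) (hmC : 0 ≤ mC)
    (D : ℕ) {ϰ : ℝ} (hϰ : 0 < ϰ) {p₀ σ c₀ : ℝ} (hp₀ : 2 / 3 < p₀) (hσ : 0 < σ) (hc₀ : 0 ≤ c₀) (hκσ : 6 + 2 * 𝔠.κ₀ < σ * (𝔠.nbar + 1)) :
    ∃ b₁ : ℝ, ∀ b₀ : ℝ, b₁ < b₀ → ∃ C : ℝ, 0 ≤ C ∧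
      ∀ (S : Scales L) (k : ℕ), k ≤ S.K → ∀ (v : ℝ), C * v ≤ 𝔠.Ca + 𝔠.Cc →
        ∀ {ι ν υ : Type} [DecidableEq ι] [Fintype ν] [Fintype υ] [DecidableEq υ] {N : ℕ} [NeZero N] (ρ : υ → υ → ℝ), IsPseudoDist ρ →
        ∀ (B : Hist S.P (k + 1) → GaugeField S.P (k + 1) G → Finset ι)
          (site : ∀ h U, ↥(B h U) → Fin dT → ZMod N) (lab : ∀ h U, ↥(B h U) → Fin m) (emb : ∀ h U, ↥(B h U) → υ)
          (Kf : Hist S.P (k + 1) → GaugeField S.P (k + 1) G → Matrix ν ν ℝ) (Q : Hist S.P (k + 1) → GaugeField S.P (k + 1) G → Matrix υ ν ℝ)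
          (Hm : Hist S.P (k + 1) → GaugeField S.P (k + 1) G → Matrix ν υ ℝ)
          (P J : Hist S.P (k + 1) → GaugeField S.P (k + 1) G → Matrix υ υ ℝ) (a : Hist S.P (k + 1) → GaugeField S.P (k + 1) G → ℝ)
          (E : ∀ h U, Matrix υ ↥(B h U) ℝ)
          (good : Hist S.P (k + 1) → GaugeField S.P (k + 1) G → (υ → ℝ) → Prop) (F : Hist S.P (k + 1) → GaugeField S.P (k + 1) G → (υ → ℝ) → ℝ)
          (κ₁ κ₂ c₂ θ : ℝ),
          -- the variables: placed on the unit torus with labels; `emb` = their position in the ambient Sect.-E index space `υ`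
          (∀ h U, (B h U).Nonempty) → (∀ h U, Function.Injective fun b => (site h U b, lab h U b)) →
          (∀ h U b b' i, (|((site h U b i - site h U b' i).valMinAbs : ℤ)| : ℝ) ≤ ρ (emb h U b) (emb h U b')) →
          -- N06's γ₀-assembly interface (pub-balaban `B9SectEKernel.gamma0_assembly`, DISPLAYED): `QH = 1`, `(K + aQᵀQ)H = QᵀP`, (h1), (h2), (hJ), the scalar `γ₀`
          (∀ h U, Q h U * Hm h U = 1) → (∀ h U, (Kf h U + a h U • ((Q h U)ᵀ * Q h U)) * Hm h U = (Q h U)ᵀ * P h U) → 0 < κ₁ →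
          (∀ h U (A : ν → ℝ), F h U (Q h U *ᵥ A) ≤ κ₁ * (A ⬝ᵥ (Kf h U *ᵥ A)) + κ₂ * ((Q h U *ᵥ A) ⬝ᵥ (Q h U *ᵥ A))) →
          (∀ h U (Bv : υ → ℝ), good h U Bv → c₂ * (Bv ⬝ᵥ Bv) ≤ F h U Bv) → (∀ h U (Bv : υ → ℝ), |Bv ⬝ᵥ (J h U *ᵥ Bv)| ≤ θ * (Bv ⬝ᵥ Bv)) →
          γ₀ ≤ (c₂ - κ₂) / κ₁ - θ →
          (∀ h U (x : ↥(B h U) → ℝ), good h U (E h U *ᵥ x)) → (∀ h U (x : ↥(B h U) → ℝ), x ⬝ᵥ x ≤ (E h U *ᵥ x) ⬝ᵥ (E h U *ᵥ x)) →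
          -- N06's Sect.-E decay inputs (DISPLAYED): (3.132)-type decay of `P` and of the J-term, `|a| ≤ a₀`, locality and column sums of `E = C`
          (∀ h U u w, P h U u w = P h U w u) → (∀ h U u w, J h U u w = J h U w u) →
          (∀ h U u w, |P h U u w| ≤ KP * Real.exp (-(δ * ρ u w))) → (∀ h U u w, |J h U u w| ≤ KJ * Real.exp (-(δ * ρ u w))) →
          (∀ h U, |a h U| ≤ a₀) → (∀ h U u b, E h U u b ≠ 0 → ρ u (emb h U b) ≤ r) → (∀ h U b, ∑ u, |E h U u b| ≤ mC) →
        ∃ (Λ : Hist S.P (k + 1) → GaugeField S.P (k + 1) G → Finset (Fin (dT + dT + 1) → ℤ)) (e : ∀ h U, ↥(B h U) ≃ ↥(Λ h U)),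
        ∀ (𝔖 : ∀ k, StepSeries S G ↥(lieC 𝔊) (nblkOf S 𝔠.lane.carrier k) k)
          (Φ : ∀ h U, (↥(B h U) → ℝ) → (𝔖 k).Fl) (H : ∀ h U, (↥(B h U) → ℝ) → ℝ)
          (s : ℕ) (Jw : Hist S.P (k + 1) → GaugeField S.P (k + 1) G → Finset (Fin (dT + dT + 1) → ℤ))
          (aw : Hist S.P (k + 1) → GaugeField S.P (k + 1) G → Coef (dT + dT + 1)),
          (∀ h U, Measurable (Φ h U)) →
          (∀ h U, (𝔖 k).μ = (gaussianFieldOfKernel fun b b' =>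
            (((E h U)ᵀ * (P h U - a h U • (1 : Matrix υ υ ℝ) - J h U) * E h U)⁻¹ : Matrix ↥(B h U) ↥(B h U) ℝ) b b').map (Φ h U)) →
          (∀ h, MeasurableSet ((𝔖 k).box h)) → (∀ h U, Measurable ((𝔖 k).𝒱 h U)) →
          (∀ h U, Φ h U ⁻¹' (𝔖 k).box h =ᵐ[gaussianFieldOfKernel fun b b' =>
            (((E h U)ᵀ * (P h U - a h U • (1 : Matrix υ υ ℝ) - J h U) * E h U)⁻¹ : Matrix ↥(B h U) ↥(B h U) ℝ) b b']
            {ω | ∀ b, |ω b| ≤ B10.pFun b₀ p₀ (S.gk k)}) →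
          (∀ h U, (fun ω => (𝔖 k).𝒱 h U (Φ h U ω)) =ᵐ[gaussianFieldOfKernel fun b b' =>
            (((E h U)ᵀ * (P h U - a h U • (1 : Matrix υ υ ℝ) - J h U) * E h U)⁻¹ : Matrix ↥(B h U) ↥(B h U) ℝ) b b'] H h U) →
          (∀ h U (z : (Fin (dT + dT + 1) → ℤ) → ℝ), H h U (fun b => z ((e h U b : ↥(Λ h U)) : Fin (dT + dT + 1) → ℤ)) =
            hamiltonian s D ϰ (aw h U) (Jw h U) z) →
          (∀ h U, Jw h U ⊆ Λ h U) → (∀ h U, coefSup s D (aw h U) (Jw h U) ≤ c₀ * S.gk k ^ σ) → (∀ h U, ((B h U).card : ℝ) ≤ v * S.sites k) →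
          ∀ h (U : GaugeField S.P (k + 1) G),
            Eq324 (∫ ω in (𝔖 k).box h, Real.exp ((𝔖 k).𝒱 h U ω) ∂(𝔖 k).μ)
              (fun n => cumulantOf (fun m => ∫ ω, (𝔖 k).𝒱 h U ω ^ m ∂(𝔖 k).μ) n) 𝔠.nbar (𝔠.Ca + 𝔠.Cc)
              ((L : ℝ) ^ k * S.g0sq) (3 + 𝔠.κ₀) (S.sites k) := by
  obtain ⟨b₁, hb₁⟩ := eq324_sectEPrecision_torus_of_gamma0Assembly_on_unit (d := dT) hdT m hγ₀ hKP hKJ ha₀ hδ hmC 𝔠.nbar D hϰ hp₀ hσ hc₀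
    (κ := 6 + 2 * 𝔠.κ₀) (by linarith [𝔠.κ₀_pos]) hκσ
  refine ⟨b₁, fun b₀ hb => ?_⟩
  obtain ⟨C, hC, hcap⟩ := hb₁ b₀ hb
  refine ⟨C, hC, ?_⟩
  intro S k hk v hCv ι ν υ _ _ _ _ N _ ρ hρ B site lab emb Kf Q Hm P J a E good F κ₁ κ₂ c₂ θ hB hinj hdom hQH hKH hκ₁ h1 h2 hJθ hγle hgood hnorm
    hPs hJs hPd hJd ha hEloc hEsum
  have hkit := fun h U => by
    haveI : Nonempty ↥(B h U) := (hB h U).coe_sort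
    exact hcap (S.gk k) (gk_pos S k) (gk_le_one S S.gK_le_one k hk) ρ hρ (site h U) (lab h U) (hinj h U) (emb h U) (hdom h U)
      (hQH h U) (hKH h U) hκ₁ (h1 h U) (h2 h U) (hJθ h U) hγle (hgood h U) (hnorm h U)
      (hPs h U) (hJs h U) (hPd h U) (hJd h U) (ha h U) (hEloc h U) (hEsum h U)
  choose Λ e hbridge hboxkit hE using hkit
  refine ⟨Λ, e, ?_⟩
  intro 𝔖 Φ H s Jw aw hΦ hμ hboxm hVm hbox hV hH hJΛ hA hBv
  refine h324Row_freeLetter_of_postConsumer_ae 𝔊 𝔠 𝔖 k (b₀ := b₀) (p₀ := p₀) hC hCv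
    (fun h U => gaussianFieldOfKernel fun x y => if hxy : x ∈ Λ h U ∧ y ∈ Λ h U then
      ((Matrix.reindex (e h U) (e h U) ((E h U)ᵀ * (P h U - a h U • (1 : Matrix υ υ ℝ) - J h U) * E h U))⁻¹ :
        Matrix ↥(Λ h U) ↥(Λ h U) ℝ) ⟨x, hxy.1⟩ ⟨y, hxy.2⟩ else 0)
    (fun h U z => Φ h U (fun b => z ((e h U b : ↥(Λ h U)) : Fin (dT + dT + 1) → ℤ)))
    (fun h U => (hΦ h U).comp (measurable_restrictAlong (e h U))) (fun h U => ?_) hboxm hVm Λ (fun h U => ?_)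
    (fun h U => hamiltonian s D ϰ (aw h U) (Jw h U)) (fun h U => ?_) ?_ (fun h U => ?_)
  · rw [hμ h U, ← hbridge h U, Measure.map_map (hΦ h U) (measurable_restrictAlong (e h U))]
    rfl
  · have hq : Measure.QuasiMeasurePreserving (fun (z : (Fin (dT + dT + 1) → ℤ) → ℝ) (b : ↥(B h U)) => z ((e h U b : ↥(Λ h U)) : Fin (dT + dT + 1) → ℤ))
        (gaussianFieldOfKernel fun x y => if hxy : x ∈ Λ h U ∧ y ∈ Λ h U then
          ((Matrix.reindex (e h U) (e h U) ((E h U)ᵀ * (P h U - a h U • (1 : Matrix υ υ ℝ) - J h U) * E h U))⁻¹ :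
            Matrix ↥(Λ h U) ↥(Λ h U) ℝ) ⟨x, hxy.1⟩ ⟨y, hxy.2⟩ else 0)
        (gaussianFieldOfKernel fun b b' =>
          (((E h U)ᵀ * (P h U - a h U • (1 : Matrix υ υ ℝ) - J h U) * E h U)⁻¹ : Matrix ↥(B h U) ↥(B h U) ℝ) b b') :=
      ⟨measurable_restrictAlong (e h U), by rw [hbridge h U]⟩
    have h1' := hq.preimage_ae_eq (hbox h U)
    rw [← Set.preimage_comp] at h1'
    haveI : Nonempty ↥(B h U) := (hB h U).coe_sort
    exact h1'.trans (preimage_box_ae_eq_smallFieldSet_of_nonneg (e h U) _ (hboxkit h U) _)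
  · have h1' := ae_eq_comp (g := fun ω => (𝔖 k).𝒱 h U (Φ h U ω)) (g' := H h U) (measurable_restrictAlong (e h U)).aemeasurable
      (μ := gaussianFieldOfKernel fun x y => if hxy : x ∈ Λ h U ∧ y ∈ Λ h U then
          ((Matrix.reindex (e h U) (e h U) ((E h U)ᵀ * (P h U - a h U • (1 : Matrix υ υ ℝ) - J h U) * E h U))⁻¹ :
            Matrix ↥(Λ h U) ↥(Λ h U) ℝ) ⟨x, hxy.1⟩ ⟨y, hxy.2⟩ else 0)
      (by rw [hbridge h U]; exact hV h U)
    refine h1'.trans (Filter.EventuallyEq.of_eq ?_)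
    funext z
    exact hH h U z
  · intro h U
    have : (Λ h U).card = (B h U).card := by
      rw [← Fintype.card_coe, ← Fintype.card_coe]; exact (Fintype.card_congr (e h U)).symm
    rw [this]; exact hBv h U
  · obtain ⟨b, hb⟩ := hB h U
    exact hE h U s (Λ h U) (Jw h U) (aw h U) ⟨_, (e h U ⟨b, hb⟩).2⟩ (hJΛ h U) (hJΛ h U) (hA h U)

/-! ## §3 PRINT's OUTPUT LETTERS: `γ₀ ≤ C*Δ_kC ≤ γ₁` and the (3.187) decay of the propagator `C̃^{(k)} = (C*Δ_kC)⁻¹` (covariance side, through seat n08-w5's door) -/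

/-- ★★★★ **ROW `h324` AT EVERY RUN STEP FROM A PRESENTATION BY `𝒩(0, T⁻¹)` ON TORUS-INDEXED VARIABLES, THE PRECISION BOUNDED `γ₀ ≤ T ≤ γ₁` AND THE PROPAGATOR `T⁻¹`
DECAYING AS (3.187)** (statement in the module docstring).  `b₁` depends on `(d_T, m, γ₀, γ₁, B₀, δ₀, D, ϰ, p₀, σ, c₀, n̄, κ₀)` only; for `b₀ > b₁` the constant `C` on those and
`b₀`; the variable sets, precisions, placements and the presentation may depend on `(h, U)` and on the step.
[cite: Balaban1985UV3, (22) p.261 + (58) p.270 + p.271 «γ₀ … γ₁»; Balaban1985BackgroundPropagators, (3.158) p.428 + Thm 3.15 (3.187) p.432;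
Balaban1982Higgs1, (3.24) p.616; BenfattoEtAl1978, Lemma p.152 (class form; ours)] -/
theorem exists_threshold_h324Row_freeLetter_of_sectECovarianceTorusPresentation_allSteps_ae {dT : ℕ} (hdT : 0 < dT) (m : ℕ)
    {γ₀ γ₁ B₀ δ₀ : ℝ} (hγ₀ : 0 < γ₀) (hγ₁ : 0 < γ₁) (hB₀ : 0 ≤ B₀) (hδ₀ : 0 < δ₀)
    (D : ℕ) {ϰ : ℝ} (hϰ : 0 < ϰ) {p₀ σ c₀ : ℝ} (hp₀ : 2 / 3 < p₀) (hσ : 0 < σ) (hc₀ : 0 ≤ c₀) (hκσ : 6 + 2 * 𝔠.κ₀ < σ * (𝔠.nbar + 1)) :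
    ∃ b₁ : ℝ, ∀ b₀ : ℝ, b₁ < b₀ → ∃ C : ℝ, 0 ≤ C ∧
      ∀ (S : Scales L) (k : ℕ), k ≤ S.K → ∀ (v : ℝ), C * v ≤ 𝔠.Ca + 𝔠.Cc →
        ∀ {ι : Type} [DecidableEq ι] {N : ℕ} [NeZero N] (B : Hist S.P (k + 1) → GaugeField S.P (k + 1) G → Finset ι)
          (site : ∀ h U, ↥(B h U) → Fin dT → ZMod N) (lab : ∀ h U, ↥(B h U) → Fin m)
          (T : ∀ h U, Matrix ↥(B h U) ↥(B h U) ℝ) (ρ : ∀ h U, ↥(B h U) → ↥(B h U) → ℝ),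
          -- the member in PRINT's letters: variables on the unit torus with labels; `γ₀ ≤ C*Δ_kC ≤ γ₁` (p.271); `|C̃^{(k)}(b,b′)| ≤ B₀e^{−δ₀ρ(b,b′)}` ((3.187)), torus metric
          (∀ h U, (B h U).Nonempty) → (∀ h U, Function.Injective fun b => (site h U b, lab h U b)) →
          (∀ h U b b', T h U b b' = T h U b' b) →
          (∀ h U (x : ↥(B h U) → ℝ), γ₀ * ∑ b, x b ^ 2 ≤ ∑ b, ∑ b', T h U b b' * x b * x b') →
          (∀ h U (x : ↥(B h U) → ℝ), ∑ b, ∑ b', T h U b b' * x b * x b' ≤ γ₁ * ∑ b, x b ^ 2) →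
          (∀ h U b b', |((T h U)⁻¹ : Matrix ↥(B h U) ↥(B h U) ℝ) b b'| ≤ B₀ * Real.exp (-(δ₀ * ρ h U b b'))) →
          (∀ h U b b' i, (|((site h U b i - site h U b' i).valMinAbs : ℤ)| : ℝ) ≤ ρ h U b b') →
        ∃ (Λ : Hist S.P (k + 1) → GaugeField S.P (k + 1) G → Finset (Fin (dT + dT + 1) → ℤ)) (e : ∀ h U, ↥(B h U) ≃ ↥(Λ h U)),
        ∀ (𝔖 : ∀ k, StepSeries S G ↥(lieC 𝔊) (nblkOf S 𝔠.lane.carrier k) k)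
          (Φ : ∀ h U, (↥(B h U) → ℝ) → (𝔖 k).Fl) (H : ∀ h U, (↥(B h U) → ℝ) → ℝ)
          (s : ℕ) (Jw : Hist S.P (k + 1) → GaugeField S.P (k + 1) G → Finset (Fin (dT + dT + 1) → ℤ))
          (aw : Hist S.P (k + 1) → GaugeField S.P (k + 1) G → Coef (dT + dT + 1)),
          -- the a.e. presentation by `𝒩(0, T⁻¹)` on the block's own variables
          (∀ h U, Measurable (Φ h U)) →
          (∀ h U, (𝔖 k).μ = (gaussianFieldOfKernel fun b b' => ((T h U)⁻¹ : Matrix ↥(B h U) ↥(B h U) ℝ) b b').map (Φ h U)) →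
          (∀ h, MeasurableSet ((𝔖 k).box h)) → (∀ h U, Measurable ((𝔖 k).𝒱 h U)) →
          (∀ h U, Φ h U ⁻¹' (𝔖 k).box h =ᵐ[gaussianFieldOfKernel fun b b' => ((T h U)⁻¹ : Matrix ↥(B h U) ↥(B h U) ℝ) b b']
            {ω | ∀ b, |ω b| ≤ B10.pFun b₀ p₀ (S.gk k)}) →
          (∀ h U, (fun ω => (𝔖 k).𝒱 h U (Φ h U ω)) =ᵐ[gaussianFieldOfKernel fun b b' => ((T h U)⁻¹ : Matrix ↥(B h U) ↥(B h U) ℝ) b b'] H h U) →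
          -- the Hamiltonian letters on the bent window (class II)
          (∀ h U (z : (Fin (dT + dT + 1) → ℤ) → ℝ), H h U (fun b => z ((e h U b : ↥(Λ h U)) : Fin (dT + dT + 1) → ℤ)) =
            hamiltonian s D ϰ (aw h U) (Jw h U) z) →
          (∀ h U, Jw h U ⊆ Λ h U) → (∀ h U, coefSup s D (aw h U) (Jw h U) ≤ c₀ * S.gk k ^ σ) → (∀ h U, ((B h U).card : ℝ) ≤ v * S.sites k) →
          ∀ h (U : GaugeField S.P (k + 1) G),
            Eq324 (∫ ω in (𝔖 k).box h, Real.exp ((𝔖 k).𝒱 h U ω) ∂(𝔖 k).μ)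
              (fun n => cumulantOf (fun m => ∫ ω, (𝔖 k).𝒱 h U ω ^ m ∂(𝔖 k).μ) n) 𝔠.nbar (𝔠.Ca + 𝔠.Cc)
              ((L : ℝ) ^ k * S.g0sq) (3 + 𝔠.κ₀) (S.sites k) := by
  obtain ⟨b₁, hb₁⟩ := eq324_sectECovariance_torus_on_unit (d := dT) hdT m hγ₀ hγ₁ hB₀ hδ₀ 𝔠.nbar D hϰ hp₀ hσ hc₀
    (κ := 6 + 2 * 𝔠.κ₀) (by linarith [𝔠.κ₀_pos]) hκσ
  refine ⟨b₁, fun b₀ hb => ?_⟩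
  obtain ⟨C, hC, hcap⟩ := hb₁ b₀ hb
  refine ⟨C, hC, ?_⟩
  intro S k hk v hCv ι _ N _ B site lab T ρ hB hinj hTs hlo hup hdec hdom
  -- n08-b's covariance-side capstone at `η := g_k`, per `(h, U)`: bent window, bijection, Gaussian bridge, box identity, (3.24) for `μ_K`
  have hkit := fun h U => by
    haveI : Nonempty ↥(B h U) := (hB h U).coe_sort
    exact hcap (S.gk k) (gk_pos S k) (gk_le_one S S.gK_le_one k hk) (site h U) (lab h U) (hinj h U) (hTs h U) (hlo h U) (hup h U)
      (hdec h U) (hdom h U)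
  choose Λ e hbridge hboxkit hE using hkit
  refine ⟨Λ, e, ?_⟩
  intro 𝔖 Φ H s Jw aw hΦ hμ hboxm hVm hbox hV hH hJΛ hA hBv
  refine h324Row_freeLetter_of_postConsumer_ae 𝔊 𝔠 𝔖 k (b₀ := b₀) (p₀ := p₀) hC hCv
    (fun h U => gaussianFieldOfKernel fun x y => if hxy : x ∈ Λ h U ∧ y ∈ Λ h U then
      (Matrix.reindex (e h U) (e h U) ((T h U)⁻¹ : Matrix ↥(B h U) ↥(B h U) ℝ) : Matrix ↥(Λ h U) ↥(Λ h U) ℝ) ⟨x, hxy.1⟩ ⟨y, hxy.2⟩ else 0)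
    (fun h U z => Φ h U (fun b => z ((e h U b : ↥(Λ h U)) : Fin (dT + dT + 1) → ℤ)))
    (fun h U => (hΦ h U).comp (measurable_restrictAlong (e h U))) (fun h U => ?_) hboxm hVm Λ (fun h U => ?_)
    (fun h U => hamiltonian s D ϰ (aw h U) (Jw h U)) (fun h U => ?_) ?_ (fun h U => ?_)
  · rw [hμ h U, ← hbridge h U, Measure.map_map (hΦ h U) (measurable_restrictAlong (e h U))]
    rfl
  · have hq : Measure.QuasiMeasurePreserving (fun (z : (Fin (dT + dT + 1) → ℤ) → ℝ) (b : ↥(B h U)) => z ((e h U b : ↥(Λ h U)) : Fin (dT + dT + 1) → ℤ))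
        (gaussianFieldOfKernel fun x y => if hxy : x ∈ Λ h U ∧ y ∈ Λ h U then
          (Matrix.reindex (e h U) (e h U) ((T h U)⁻¹ : Matrix ↥(B h U) ↥(B h U) ℝ) : Matrix ↥(Λ h U) ↥(Λ h U) ℝ) ⟨x, hxy.1⟩ ⟨y, hxy.2⟩ else 0)
        (gaussianFieldOfKernel fun b b' => ((T h U)⁻¹ : Matrix ↥(B h U) ↥(B h U) ℝ) b b') :=
      ⟨measurable_restrictAlong (e h U), by rw [hbridge h U]⟩
    have h1 := hq.preimage_ae_eq (hbox h U)
    rw [← Set.preimage_comp] at h1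
    haveI : Nonempty ↥(B h U) := (hB h U).coe_sort
    exact h1.trans (preimage_box_ae_eq_smallFieldSet_of_nonneg (e h U) _ (hboxkit h U) _)
  · have h1 := ae_eq_comp (g := fun ω => (𝔖 k).𝒱 h U (Φ h U ω)) (g' := H h U) (measurable_restrictAlong (e h U)).aemeasurable
      (μ := gaussianFieldOfKernel fun x y => if hxy : x ∈ Λ h U ∧ y ∈ Λ h U then
          (Matrix.reindex (e h U) (e h U) ((T h U)⁻¹ : Matrix ↥(B h U) ↥(B h U) ℝ) : Matrix ↥(Λ h U) ↥(Λ h U) ℝ) ⟨x, hxy.1⟩ ⟨y, hxy.2⟩ else 0)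
      (by rw [hbridge h U]; exact hV h U)
    refine h1.trans (Filter.EventuallyEq.of_eq ?_)
    funext z
    exact hH h U z
  · intro h U
    have : (Λ h U).card = (B h U).card := by
      rw [← Fintype.card_coe, ← Fintype.card_coe]; exact (Fintype.card_congr (e h U)).symm
    rw [this]; exact hBv h U
  · obtain ⟨b, hb⟩ := hB h U
    exact hE h U s (Λ h U) (Jw h U) (aw h U) ⟨_, (e h U ⟨b, hb⟩).2⟩ (hJΛ h U) (hJΛ h U) (hA h U)

end Summit.QuantumFields.YangMills.Theorems.BalabanUVNodesN08AlphaEq324RowClassSocketEndSectE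

end
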